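import Mathlib
import HarnessLib
import Summits.CriticalPhenomena.PercolationContinuityZ3.Theses.PercBurnResprinkle
import Literature.Probability.Percolation.HalfSpace

/-!
# Sketch — crux-ideate stmt-CriticalPhenomena-7203 (VacantReignition), ideator 1, round 1

First-lemma signatures for the idea cards (they need not be proved; they must elaborate).
All statements are over existing declarations (`labelMeasure`, `configOfLabels`, `openCluster`,
`openGraph`, `criticalProb`, `criticalProbI`, `theta`, `zdGraph`, `box`) plus the small
abbreviations `burnt`, `freshOff`, `blockNbhd`, `dustEdge`, `armSet` defined here, each of which
unfolds to existing declarations.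
-/

noncomputable section

namespace Summit.CriticalPhenomena.PercolationContinuityZ3.Cruxes.VacantReignition.Sketch

open MeasureTheory Literature.Probability.Percolation Literature.Probability.LatticeModels
open Summit.CriticalPhenomena.PercolationContinuityZ3.Theses.PercBurnResprinkle (VacantReignition)

/-- `p_c(ℤ³)` as a real. -/
abbrev pc : ℝ := criticalProb (zdGraph 3) (0 : Site 3)

/-- The law of the pair (environment labels `U`, fresh labels `U'`). -/
abbrev μ2 : Measure ((Sym2 (Site 3) → ℝ) × (Sym2 (Site 3) → ℝ)) :=
  (labelMeasure (Site 3)).prod (labelMeasure (Site 3))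

/-- The burnt set `I_p(U)`: vertices lying in an infinite cluster of `ω_p = {U ≤ p}`. -/
def burnt (p : ℝ) (U : Sym2 (Site 3) → ℝ) : Set (Site 3) :=
  {y | (openCluster (configOfLabels p U (zdGraph 3)) y).Infinite}

/-- The fresh configuration at level `q` from labels `U'`, keeping only edges with both
endpoints outside `S` (Bernoulli(q) bond percolation on `ℤ³[ℤ³ ∖ S]`). -/
def freshOff (q : ℝ) (U' : Sym2 (Site 3) → ℝ) (S : Set (Site 3)) : BondConfig (Site 3) :=
  {e | e ∈ configOfLabels q U' (zdGraph 3) ∧ ∀ y ∈ e, y ∉ S}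

/-- Sanity: the crux is literally `∀ ε>0 ∃ p>p_c, 0 < μ2.real {π | 0 percolates in
freshOff (p_c+ε) π.2 (burnt p π.1)}`. -/
example : VacantReignition ↔
    ∀ ε : ℝ, 0 < ε → ∃ p : ℝ, pc < p ∧
      0 < μ2.real {π | (openCluster (freshOff (pc + ε) π.2 (burnt p π.1)) (0 : Site 3)).Infinite} :=
  Iff.rfl

/-! ## Card A — strip the fresh field (GM static renormalisation + Liggett–Schonmann–Stacey) -/

/-- The `3a`-neighbourhood of the block of side `a` indexed by `z ∈ ℤ³`. -/
def blockNbhd (a : ℕ) (z : Site 3) : Set (Site 3) :=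
  {y | ∀ i, (a : ℤ) * (z i - 1) ≤ y i ∧ y i < (a : ℤ) * (z i + 2)}

/-- A designated lattice edge of block `z` whose FRESH label serves as independent
Bernoulli dust (distinct blocks have distinct designated edges). -/
def dustEdge (a : ℕ) (z : Site 3) : Sym2 (Site 3) :=
  s((a : ℤ) • z, (a : ℤ) • z + Pi.single 0 1)

/-- Block `z` is usable at level `p`, side `a`, dust density `ρ`: its `3a`-neighbourhood misses
the burnt set and its dust label is `≤ ρ`. -/
def usableBlock (p : ℝ) (a : ℕ) (ρ : ℝ) (π : (Sym2 (Site 3) → ℝ) × (Sym2 (Site 3) → ℝ))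
    (z : Site 3) : Prop :=
  (∀ y ∈ blockNbhd a z, y ∉ burnt p π.1) ∧ π.2 (dustEdge a z) ≤ ρ

/-- **NoCagesFat** (`C⁺` of card A): for some `ρ < 1`, for every block side `a`, for some
`p > p_c`, with positive probability the block of the origin lies in an infinite
nearest-neighbour chain of usable blocks — Bernoulli(ρ)-robust percolation of the vacant blocks
of the `a`-fattened burnt set. -/
def NoCagesFat : Prop :=
  ∃ ρ : ℝ, ρ < 1 ∧ ∀ a : ℕ, 0 < a → ∃ p : ℝ, pc < p ∧
    0 < μ2.real {π | (openCluster {E | E ∈ (zdGraph 3).edgeSet ∧ ∀ z ∈ E, usableBlock p a ρ π z}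
      (0 : Site 3)).Infinite}

/-- **First lemma of card A**: robust block-vacancy of the fattened burnt set implies the crux
(GM static renormalisation of the fresh Bernoulli(p_c+ε) field at block scale `a = a(ε, ρ)`,
Liggett–Schonmann–Stacey domination of the finitely dependent good-block field by Bernoulli(ρ)
independently of `U`, gluing of crossing clusters inside vacant block neighbourhoods, finite
energy at the origin). -/
def FirstLemmaA : Prop := NoCagesFat → VacantReignition

/-! ## Card B — receding half-space islands (BGN plane-shattering of the critical burnt set) -/

/-- **NF** — the critical burnt set is not a fire-break: for every `ε > 0` fresh
Bernoulli(p_c+ε) percolation off `I_{p_c}` percolates from the origin with positive probability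
(trivial when `θ(p_c) = 0`; the consumed core of the crux otherwise). -/
def NotFireBreak : Prop :=
  ∀ ε : ℝ, 0 < ε →
    0 < μ2.real {π | (openCluster (freshOff (pc + ε) π.2 (burnt pc π.1)) (0 : Site 3)).Infinite}

/-- **RC** — right-continuity of the burnt threshold at `p_c` (recovery proper): whatever
fresh level `q` percolates off the CRITICAL burnt set still percolates, after an arbitrarily
small extra sprinkle, off a slightly SUPERcritical burnt set. Its smallness input
(`I_p ↓ I_{p_c}` a.s., density `θ(p) - θ(p_c) → 0`) holds in every world. -/
def BurntThresholdRightCont : Prop :=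
  ∀ q ε : ℝ, 0 < ε →
    0 < μ2.real {π | (openCluster (freshOff q π.2 (burnt pc π.1)) (0 : Site 3)).Infinite} →
      ∃ p : ℝ, pc < p ∧
        0 < μ2.real {π | (openCluster (freshOff (q + ε) π.2 (burnt p π.1)) (0 : Site 3)).Infinite}

/-- The world-independent split of the crux: `S1 ⟸ NF ∧ RC` (apply NF at `ε/2`, then RC with
`q = p_c + ε/2` and sprinkle `ε/2`). -/
def SplitLemma : Prop := NotFireBreak → BurntThresholdRightCont → VacantReignition

/-- **Islands are finite** (Barsky–Grimmett–Newman `θ_ℍ(p_c) = 0`, all worlds): almost surely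
no vertex of the open upper half-space `{x₀ ≥ 1}` lies in an infinite cluster of the level-`p_c`
configuration restricted to `{x₀ ≥ 1}`; hence `I_{p_c} ∩ {x₀ ≥ 1}` is a union of FINITE
islands each hanging from the plane `{x₀ = 0}`. -/
def IslandsFinite : Prop :=
  labelMeasure (Site 3)
    {U | ∃ x : Site 3, 1 ≤ x 0 ∧
      (openCluster {e | e ∈ configOfLabels pc U (zdGraph 3) ∧ ∀ y ∈ e, 1 ≤ y 0} x).Infinite} = 0

/-- **HighVacancy** (the lever's target, jump world only): if `θ(p_c) > 0` then for every
`ε > 0` some receding half-space `{x₀ ≥ h}` carries, with positive probability, an infinite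
fresh Bernoulli(p_c+ε) cluster avoiding the critical burnt set. -/
def HighVacancy : Prop :=
  0 < theta (zdGraph 3) (0 : Site 3) (criticalProbI 3) →
    ∀ ε : ℝ, 0 < ε → ∃ h : ℤ, ∃ x : Site 3,
      0 < μ2.real {π | (openCluster {e | e ∈ freshOff (pc + ε) π.2 (burnt pc π.1) ∧ ∀ y ∈ e, h ≤ y 0}
        x).Infinite}

/-- **First lemma of card B**: high vacancy in a jump world gives NF (monotonicity in the
half-space restriction + translation invariance of `μ2`; the `θ(p_c) = 0` case of NF is
`θ(p_c+ε) > 0` since then `I_{p_c} = ∅` a.s.). -/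
def FirstLemmaB : Prop := HighVacancy → NotFireBreak

/-! ## Card C — correlation-length seed (supercritical locality of the burnt set) -/

/-- The `R`-arm set at level `p`: vertices joined by an open path to sup-distance `≥ R`.
It contains the burnt set for every `R`, is `2R`-local, and differs from it on a set of density
`≤ P_p(R ≤ rad C(0) < ∞)`, exponentially small in `R/ξ(p)` at fixed `p > p_c`. -/
def armSet (p : ℝ) (R : ℕ) (U : Sym2 (Site 3) → ℝ) : Set (Site 3) :=
  {y | ∃ z : Site 3, (R : ℝ) ≤ dist y z ∧ (openGraph (configOfLabels p U (zdGraph 3))).Reachable y z}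

/-- Usable block for the LOCAL proxy: neighbourhood misses the `R`-arm set, dust label `≤ ρ`. -/
def usableBlockLoc (p : ℝ) (R a : ℕ) (ρ : ℝ) (π : (Sym2 (Site 3) → ℝ) × (Sym2 (Site 3) → ℝ))
    (z : Site 3) : Prop :=
  (∀ y ∈ blockNbhd a z, y ∉ armSet p R π.1) ∧ π.2 (dustEdge a z) ≤ ρ

/-- The block-edge configuration of usable local blocks. -/
def usableCfg (p : ℝ) (R a : ℕ) (ρ : ℝ) (π : (Sym2 (Site 3) → ℝ) × (Sym2 (Site 3) → ℝ)) :
    BondConfig (Site 3) :=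
  {E | E ∈ (zdGraph 3).edgeSet ∧ ∀ z ∈ E, usableBlockLoc p R a ρ π z}

/-- **SeedEstimate** (`C⁺` of card C): a ONE-BOX finite-size criterion for the finitely
dependent field of usable local blocks — some box of blocks of half-side `N` (with `N` large
against the dependence range `R/a`) is crossed between opposite faces inside the box in every
coordinate direction, and any two block-clusters of the box reaching sup-distance `N` are joined
inside the doubled box, with probability at least `1 - 10⁻⁶` (any fixed constant below the
26-dependent site threshold works). -/
def SeedEstimate : Prop :=
  ∃ ρ : ℝ, ρ < 1 ∧ ∀ a : ℕ, 0 < a → ∃ p : ℝ, pc < p ∧ ∃ R N : ℕ, R < a * N ∧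
    1 - (1e-6 : ℝ) ≤ μ2.real {π |
      (∀ i : Fin 3, ∃ z ∈ (box 3 N : Set (Site 3)), ∃ z' ∈ (box 3 N : Set (Site 3)),
          z i = -(N : ℤ) ∧ z' i = N ∧ usableCfg p R a ρ π ∈ openConnIn (box 3 N : Set (Site 3)) z z') ∧
      (∀ z ∈ (box 3 N : Set (Site 3)), ∀ z' ∈ (box 3 N : Set (Site 3)),
          (∃ w, (N : ℝ) ≤ dist z w ∧ usableCfg p R a ρ π ∈ openConnIn (box 3 N : Set (Site 3)) z w) →
          (∃ w', (N : ℝ) ≤ dist z' w' ∧ usableCfg p R a ρ π ∈ openConnIn (box 3 N : Set (Site 3)) z' w') →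
          usableCfg p R a ρ π ∈ openConnIn (box 3 (2 * N) : Set (Site 3)) z z')}

/-- `NoCagesFat` for the local proxy (implies `NoCagesFat` since `burnt ⊆ armSet`). -/
def NoCagesFatLocal : Prop :=
  ∃ ρ : ℝ, ρ < 1 ∧ ∀ a : ℕ, 0 < a → ∃ p : ℝ, pc < p ∧ ∃ R : ℕ,
    0 < μ2.real {π | (openCluster (usableCfg p R a ρ π) (0 : Site 3)).Infinite}

/-! ### Card C proper — FKG shell chaining across dyadic scales -/

/-- A usable-block walk inside `box 3 (4m)` from the inner box `box 3 m` to the layer where some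
coordinate equals `±4m` (a "radial crossing" of the block annulus at scale `m`). -/
def radialAt (p : ℝ) (R a : ℕ) (ρ : ℝ) (π : (Sym2 (Site 3) → ℝ) × (Sym2 (Site 3) → ℝ)) (m : ℕ) :
    Prop :=
  ∃ z ∈ (box 3 m : Set (Site 3)), ∃ z' : Site 3, (∃ i, z' i = 4 * (m : ℤ) ∨ z' i = -(4 * (m : ℤ))) ∧
    usableCfg p R a ρ π ∈ openConnIn (box 3 (4 * m) : Set (Site 3)) z z'

/-- A usable separating SHELL at scale `m`: a finite, lattice-connected set of usable blocks inside
`box 3 (4m) ∖ box 3 (2m)` met by every lattice walk from `box 3 (2m)` to the `±4m` layer. In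
`d = 3` paths need not meet paths, but every path meets a separating shell. -/
def shellAt (p : ℝ) (R a : ℕ) (ρ : ℝ) (π : (Sym2 (Site 3) → ℝ) × (Sym2 (Site 3) → ℝ)) (m : ℕ) :
    Prop :=
  ∃ S : Finset (Site 3),
    (∀ s ∈ S, usableBlockLoc p R a ρ π s ∧ s ∈ box 3 (4 * m) ∧ s ∉ box 3 (2 * m)) ∧
    ((zdGraph 3).induce (S : Set (Site 3))).Connected ∧
    ∀ z ∈ (box 3 (2 * m) : Set (Site 3)), ∀ z' : Site 3,
      (∃ i, z' i = 4 * (m : ℤ) ∨ z' i = -(4 * (m : ℤ))) →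
        ∀ w : (zdGraph 3).Walk z z', ∃ s ∈ S, s ∈ w.support

/-- **ShellChainLemma** (first lemma of card C; provable now: Harris–FKG for the product label
measure, all events being decreasing in the level-`p` environment and increasing in the dust,
plus the bookkeeping "radial walk at scale `2m` and at scale `m` both meet the shell at scale
`m`"): per-scale POSITIVITY of radial crossings and shells at the dyadic scales `2^k m₀`
(free below any fixed scale by finite energy) and a SUMMABLE TAIL force robust percolation of
the usable blocks from the origin. The tail is a fixed-`p`, scales-to-infinity statement. -/
def ShellChainLemma : Prop :=
  ∀ (ρ : ℝ) (a : ℕ) (p : ℝ) (R m₀ : ℕ) (q : ℝ), 0 < q → 0 < m₀ →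
    q ≤ μ2.real {π | ∃ z' : Site 3, (∃ i, z' i = 4 * (m₀ : ℤ) ∨ z' i = -(4 * (m₀ : ℤ))) ∧
          usableCfg p R a ρ π ∈ openConnIn (box 3 (4 * m₀) : Set (Site 3)) 0 z'} →
    (∀ k : ℕ, q ≤ μ2.real {π | radialAt p R a ρ π (2 ^ k * m₀)} ∧
              q ≤ μ2.real {π | shellAt p R a ρ π (2 ^ k * m₀)}) →
    (∃ K : ℕ, ∀ k : ℕ, K ≤ k →
        1 - (2 : ℝ)⁻¹ ^ k ≤ μ2.real {π | radialAt p R a ρ π (2 ^ k * m₀) ∧ shellAt p R a ρ π (2 ^ k * m₀)}) →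
    0 < μ2.real {π | (openCluster (usableCfg p R a ρ π) (0 : Site 3)).Infinite}

/-- **StrongTail** (`C⁺` of card C): for some `ρ < 1` and every block side `a` there are a level
`p > p_c`, a truncation `R` and a bottom scale `m₀` such that radial usable crossings and usable
shells at scale `2^k m₀` fail with probability at most `2^{-k}` for all large `k` — strong
(static-renormalisation grade) percolation of the usable set at ONE fixed supercritical
parameter, at scales tending to infinity. -/
def StrongTail : Prop :=
  ∃ ρ : ℝ, ρ < 1 ∧ ∀ a : ℕ, 0 < a → ∃ p : ℝ, pc < p ∧ ∃ R m₀ K : ℕ, 0 < m₀ ∧ ∀ k : ℕ, K ≤ k →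
    1 - (2 : ℝ)⁻¹ ^ k ≤ μ2.real {π | radialAt p R a ρ π (2 ^ k * m₀) ∧ shellAt p R a ρ π (2 ^ k * m₀)}

/-- Card C's transfer in one line: the strong tail gives robust local block vacancy (window scales
are free by finite energy + `ShellChainLemma`), hence `NoCagesFat`, hence (card A) the crux. -/
def TransferC : Prop := StrongTail → NoCagesFatLocal

/-- **First lemma of card C**: the one-box seed estimate implies robust vacancy of the local
proxy (finite-size criterion for finitely dependent block percolation on `ℤ³`:
Liggett–Schonmann–Stacey + static renormalisation), hence `NoCagesFat`, hence (card A) the crux. -/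
def FirstLemmaC : Prop := SeedEstimate → NoCagesFatLocal

/-- Bookkeeping: the local proxy dominates. -/
def LocalToGlobal : Prop := NoCagesFatLocal → NoCagesFat

end Summit.CriticalPhenomena.PercolationContinuityZ3.Cruxes.VacantReignition.Sketch
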